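import Literature.AlgebraicGeometry.Frobenioids.PadicFrobenioidPerfection
import Literature.AlgebraicGeometry.Frobenioids.ModelFrobenioidBaseChangeEquivalence
import Literature.AlgebraicGeometry.Frobenioids.SelfEquivalenceKernelTransport
import Literature.AlgebraicGeometry.Frobenioids.PadicFrobenioidSelfEquivalenceUnits
import Literature.AlgebraicGeometry.Frobenioids.PadicFrobenioidLogpDivisorTransport
import HarnessLib

/-!
# Frobenioids II, Example 1.1 (ii): the `p`-adic Frobenioid of a subfunctor `Φ ⊆ Φ₀|_D` — in particular of the
# perfection `Φ = ord(O^⊳)^pf` ([IUTchI] Ex. 3.3 (i) `𝒞_v`) — is FUNCTORIAL IN ISOMORPHISMS OF THE BASE FUNCTOR `D → D₀`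

Mochizuki, *The geometry of Frobenioids II*, Kyushu J. Math. **62** (2008) 401–460, §1, Example 1.1 (ii), p. 8, verbatim
(own render of the kurims file, p. 8 ll. 49–65; `[…]` marks our one elision): «Let `D` be a connected, totally epimorphic
category, `D → D₀` a functor.  Let `Φ ⊆ Φ₀^Λ|_D (= Φ₀|_D)` be a monoprime [cf. [Mzk5], §0; the convention of [Mzk5],
Definition 1.1, (ii)] subfunctor in monoids such that the image of the resulting homomorphism of group-like monoids on `D`
`B := B₀^Λ|_D ×_{(Φ₀^Λ)^gp|_D} Φ^gp → Φ^gp` determines a subfunctor in nonzero monoids of `Φ^gp` […].  We shall refer to as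
a *`p`-adic Frobenioid* the Frobenioid `C` that arises as the model Frobenioid associated to this data `Φ`, `B → Φ^gp`
[cf. [Mzk5], Theorem 5.2, (ii)].» [cite: MochizukiFrdII2008, Ex 1.1 (ii) p.8].  NORMALISATION (ours, stated outside the
quotation): this file — like abc-iut-L1-t4's `PadicFrobenioidPerfection` (`Datum`, `SubDatum`) on which it rests — works at
monoid type `Λ = ℤ`, where `B₀^Λ = B₀ : Spec K ↦ K^×` and, as print notes, `Φ₀^Λ|_D = Φ₀|_D`; this is the case
[IUTchI] Example 3.3 (i) instantiates (p. 78: «[cf. [FrdII], Example 1.1, (ii), where we take “Λ” to be Z]»); in the rest of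
this docstring print's display is accordingly written `B = B₀|_D ×_{Φ₀^gp|_D} Φ^gp`.  *The geometry of Frobenioids I*, Kyushu
J. Math. **62** (2008) 293–400, Thm. 5.2 (i) p. 100 («A well-defined category `C` may be constructed in the following
fashion» — the construction from the data `Φ`, `B`, `Div_B : B → Φ^gp`) and Thm. 5.2 (ii) p. 101 («We shall refer to `C` as
the model Frobenioid defined by the divisor monoid `Φ` and the rational function monoid `B`» — the item Example 1.1 (ii)
points at), Prop. 5.3 p. 103 («the functors that arise naturally from the construction») and Cor. 5.4 p. 104 («the
horizontal arrows are equivalences of categories») [cite: MochizukiFrdI2008, Thm. 5.2(i) p.100]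
[cite: MochizukiFrdI2008, Thm. 5.2(ii) p.101] [cite: MochizukiFrdI2008, Cor. 5.4 p.104].  S. Mochizuki, *Inter-universal
Teichmüller theory I*, kurims manuscript (May 2020), Cor. 5.3 (ii) p. 144: «Then the natural map `Isom(¹𝔉, ²𝔉) → Isom(¹𝔇, ²𝔇)`
[cf. Remark 5.2.1, (i)] is bijective» — of this BIJECTIVITY, §3 below serves the injectivity half only ([IUTchI] Cor 5.3 (ii)
p.144) [claim: Mochizuki2012, status: disputed] (D-0012 claim key; nothing of the series is asserted and no side is taken on
[IUTchIII] Cor. 3.12).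

PROOF-ONLY file (cell abc-iut; seat abc-iut-L1-t4 gen 19; row R67/J2 «DATUM-PERF-BASE-ISO-FUNCTORIALITY» of the L5 hub
junction J-C53-BASE-ISO, L1-lead R191; spec abc-iut-L1-t7 gen 9).  The printed construction — schematically (our
notation, not a quotation) `(D → D₀, Φ ⊆ Φ₀|_D) ↦ C` — depends on the base functor `D → D₀` only through the restricted
monoids `Φ₀|_D`, `B₀|_D` and `B₀|_D → Φ₀^gp|_D`; a natural
transformation `e : base₂ ⟶ base₁` of base functors therefore induces, by `Φ₀(e_A)`, `B₀(e_A)` and the naturality of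
`B₀ → Φ₀^gp` (abc-iut-L1-t4's `divZero`), a MORPHISM OF MODEL DATA over `𝟭_D` (abc-iut-L1-t5's `ModelFrobenioid.DataHom`,
abc-iut-w5-d048's `DataHomOver`) between the data of two subfunctors `Φ₁ ⊆ Φ₀|_{base₁}`, `Φ₂ ⊆ Φ₀|_{base₂}` exchanged by `e`
(abc-iut-L1-t4's `SubDatum`), hence a functor of `p`-adic Frobenioids over the IDENTITY of `D`; for a natural ISOMORPHISM
the components are bijective, so abc-iut-w5-d137's `DataHomOver.functor_isEquivalence` ([FrdI] Cor. 5.4) makes it an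
EQUIVALENCE lying over `𝟭_D` on the nose (abc-iut-w5-d048's `functor_comp_baseFunctor`):
* §0 `map_op_hom_map_op_inv_apply` / `map_op_inv_map_op_hom_apply` — bookkeeping: `F(i.hom) ∘ F(i.inv) = id` elementwise
  for a `CommMonCat`-valued presheaf and an isomorphism `i`;
* §1 `SubDatum.exists_dataHomOver_of_baseHom` — the data morphism over `𝟭_D` induced by `e : base₂ ⟶ base₁` carrying
  `Φ₁` into `Φ₂` (`η_A = Φ₀(e_A)|_{Φ₁(A)}`, `β_A = (B₀(e_A), η_A^gp)` on `B = B₀|_D ×_{Φ₀^gp} Φ^gp`), with its two value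
  formulas; `SubDatum.bijective_of_baseIso` — bijectivity of `η`, `β` when `e` is an isomorphism exchanging `Φ₁`, `Φ₂`;
  `SubDatum.exists_equivalence_of_baseIso` — the induced EQUIVALENCE `C₁ ≌ C₂` with `F ⋙ Base₂ = Base₁` and
  `deg_Fr(F φ) = deg_Fr(φ)`;
* §2 `Datum.exists_equivalence_perf_of_baseIso` — THE HEADLINE at the perfection `Φ = ord(O^⊳)^pf` (stable under every
  `Φ₀(g)`, `Realification.map_mem_perf`): for `eb : base₁ ≅ base₂`,
  `∃ F : (Datum.perf base₁ …).frobenioid ≌ (Datum.perf base₂ …).frobenioid` over `𝟭_D`; `Datum.perf_isFieldwiseSaturated`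
  (abc-iut-L1-d6 gen 13's one-liner, staged unfiled — taken here with credit);
* §3 the junction: `Datum.perf_kernelTrivial_of_baseIso` / `_iff_` — abc-iut-L5-t4's kernel-triviality clause `hker`
  (in words, ours: every self-equivalence of `𝒞_v` lying over `𝟭_{𝒟_v}` is `≅ 𝟭`) TRANSPORTS between the perfection
  Frobenioids of isomorphic bases (abc-iut-L1-t7's `CatIsomorphism.kernelTrivial_of_equivalence_over`, p504709; the
  equivalence criterion consumed in §1–§2 is abc-iut-w5-d137's `DataHomOver.functor_isEquivalence`, declared in its own
  file under [FrdI] Cor. 5.4 — print's Cor. 5.4 itself concerns realifications); and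
  `Datum.perf_hker_of_baseIso_genuine` — abc-iut-L1-t7's `PadicFrd.Datum.hker_genuine` (p504140; genuine §2 base
  `φ₁ : Π → G_{ℚ_p}`) HOLDS AT `Datum.perf base …` FOR EVERY base functor `base` ISOMORPHIC to the genuine form
  `CosetCat.push φ₁ ⋙ CosetCat.toConnected ⋙ galoisPadicFields p` — the `hd`-as-ISO form asked for by the L5 carriers
  `GoodLocalFrobenioid.ofGalois …` (whose base `CosetCat.push aug ⋙ d.fieldFunctor` is isomorphic, not equal, to it;
  the isomorphism itself = junction (J1), GaloisValDatum side, is NOT constructed here).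
No definition, instance, notation or `Prop`-valued fact; nothing of abc-iut-L1-t7's / abc-iut-L1-d6's / abc-iut-L5-t4's
files is restated (consumed BY NAME); typed ≠ proved elsewhere; nothing here asserts abc proved or refuted.

Related (L1-lead R193/R196): abc-iut-w4-d047's `PadicFrobenioidPerfMulTransport.lean` (p507212) builds, as NAMED definitions
`PadicFrd.perfMulTransportη` / `perfMulTransportβ` / `perfMulTransport`, the data morphism between two PERFECTION data over the same
base from a natural family of MULTIPLICATIVE integral maps of unit groups `τ_A : K_A^× → K'_A^×` (not necessarily additive — the
anabelian transporters of [AbsTopIII] Prop. 3.2 (iv)), bijective for an integral inverse family (`perfMulTransportη_bijective`,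
`perfMulTransportβ_bijective`).  The present file is the RING-valued case through the base category's own functor maps
`(phiZero p).map`, `(bZero p).map` of a morphism / isomorphism of base functors `D → D₀`, for an ARBITRARY pair of subfunctors
`Φ_i ⊆ Φ₀|_{base_i}` (`SubDatum`), packaged existentially (0 definitions); the two overlap exactly at `τ_A := Units.map (e_A).alg`
for the perfection, where either route yields the same components `η_A = Φ₀(e_A)|_{Φ₁(A)}`, `β_A = (B₀(e_A), η_A^gp)`.

Revision note (abc-iut-L1-t4 gen 20, doc-only): the citation paragraph above now quotes [FrdII] Ex. 1.1 (ii), [FrdI] Thm. 5.2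
(i)/(ii), Prop. 5.3, Cor. 5.4 and [IUTchI] Cor. 5.3 (ii) verbatim from the seat's own renders, with print's `Λ`-superscripts
kept and the `Λ = ℤ` normalisation stated outside the quotation (referee items I30-n1 / C31; audit INFO on the Thm. 5.2
pointer and on «bijective»); all declarations below are unchanged.
-/

namespace Literature.AlgebraicGeometry.Frobenioids

open CategoryTheory Opposite Function Literature.IUT.HodgeTheaters

namespace PadicFrd

universe v u

/-! ### §0 Bookkeeping: a `CommMonCat`-valued presheaf on an isomorphism, elementwise -/

section Presheaf

variable {C : Type*} [Category C] (F : Cᵒᵖ ⥤ CommMonCat.{u}) {X Y : C} (i : X ≅ Y)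

/-- `F(i) (F(i⁻¹) x) = x` for a presheaf of commutative monoids `F` and an isomorphism `i : X ≅ Y` (`x ∈ F(X)`).
[cite: MochizukiFrdI2008, Def. 1.1(ii) p.19] -/
theorem map_op_hom_map_op_inv_apply (x : F.obj (op X)) : (F.map i.hom.op).hom ((F.map i.inv.op).hom x) = x := by
  rw [← MonoidHom.comp_apply, ← CommMonCat.hom_comp, ← F.map_comp, ← op_comp, Iso.hom_inv_id, op_id, F.map_id,
    CommMonCat.hom_id, MonoidHom.id_apply]

/-- `F(i⁻¹) (F(i) y) = y` for a presheaf of commutative monoids `F` and an isomorphism `i : X ≅ Y` (`y ∈ F(Y)`).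
[cite: MochizukiFrdI2008, Def. 1.1(ii) p.19] -/
theorem map_op_inv_map_op_hom_apply (y : F.obj (op Y)) : (F.map i.inv.op).hom ((F.map i.hom.op).hom y) = y := by
  rw [← MonoidHom.comp_apply, ← CommMonCat.hom_comp, ← F.map_comp, ← op_comp, Iso.inv_hom_id, op_id, F.map_id,
    CommMonCat.hom_id, MonoidHom.id_apply]

end Presheaf

variable {D : Type u} [Category.{v} D] {p : ℕ}

/-! ### §1 The data morphism over `𝟭_D` induced by a morphism of base functors, for subfunctors `Φ ⊆ Φ₀|_D` -/

namespace SubDatum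

variable {base₁ base₂ : D ⥤ PadicFld.{u} p} (T₁ : SubDatum base₁) (T₂ : SubDatum base₂)

/-- **`Φ ⊆ Φ₀|_D ↦ (Φ, B, Div_B)` is functorial in the base functor.**  A natural transformation `e : base₂ ⟶ base₁` of
base functors `D → D₀` such that `Φ₀(e_A)` carries `Φ₁(A)` into `Φ₂(A)` induces a morphism of model data OVER `𝟭_D`
from `(Φ₁, B₁, Div_{B₁})` to `(Φ₂, B₂, Div_{B₂})` (`B_i = B₀|_D ×_{Φ₀^gp|_D} Φ_i^gp`): `η_A = Φ₀(e_A)|_{Φ₁(A)}` and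
`β_A = (B₀(e_A), η_A^gp)` — the fibre condition of `β_A` being the naturality of `B₀ → Φ₀^gp` at `e_A` — recorded with the
two value formulas `ι₂ ∘ η_A = Φ₀(e_A) ∘ ι₁` and `pr_{B₀} ∘ β_A = B₀(e_A) ∘ pr_{B₀}`. [cite: MochizukiFrdII2008, Ex 1.1 (ii) p.8] -/
theorem exists_dataHomOver_of_baseHom (e : base₂ ⟶ base₁)
    (hS : ∀ (A : D) (x : Realification (OrdInt (base₁.obj A).K)), x ∈ T₁.S A →
      ((phiZero p).map (e.app A).op).hom x ∈ T₂.S A) :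
    ∃ h : ModelFrobenioid.DataHomOver (𝟭 D) T₁.divB T₂.divB,
      (∀ (A : D) (c : T₁.Φ.obj (op A)),
        (T₂.ι.app (op A)).hom ((h.η.app (op A)).hom c) = ((phiZero p).map (e.app A).op).hom ((T₁.ι.app (op A)).hom c)) ∧
      (∀ (A : D) (b : T₁.B.obj (op A)),
        (T₂.toB0.app (op A)).hom ((h.β.app (op A)).hom b) =
          ((bZero p).map (e.app A).op).hom ((T₁.toB0.app (op A)).hom b)) := by
  -- `η₀ := Φ₀(e)`, `β₀ := B₀(e)` as natural transformations `Φ₀|_{base₁} → Φ₀|_{base₂}`, `B₀|_{base₁} → B₀|_{base₂}` on `Dᵒᵖ`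
  let η₀ : phiZeroOn base₁ ⟶ phiZeroOn base₂ := Functor.whiskerRight (NatTrans.op e) (phiZero p)
  let β₀ : bZeroOn base₁ ⟶ bZeroOn base₂ := Functor.whiskerRight (NatTrans.op e) (bZero p)
  -- the component `η_A : Φ₁(A) → Φ₂(A)`
  let ηhom : ∀ A : Dᵒᵖ, T₁.S A.unop →* T₂.S A.unop := fun A =>
    ((η₀.app A).hom.restrict (T₁.S A.unop)).codRestrict (T₂.S A.unop) fun x => hS A.unop x.1 x.2
  let η : T₁.Φ ⟶ (𝟭 D).op ⋙ T₂.Φ :=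
    { app := fun A => CommMonCat.ofHom (ηhom A)
      naturality := fun A A' f => by
        apply CommMonCat.hom_ext
        refine MonoidHom.ext fun x => Subtype.ext ?_
        have n0 := congrArg (fun φ => φ.hom x.1) (η₀.naturality f)
        simp only [CommMonCat.hom_comp, MonoidHom.comp_apply] at n0
        exact n0 }
  -- `Φ₀(e_A) ∘ ι₁ = ι₂ ∘ η_A`: the inclusions intertwine `η` with `η₀`
  have hιη : ∀ A : Dᵒᵖ, (η₀.app A).hom.comp (T₁.ι.app A).hom = (T₂.ι.app A).hom.comp (ηhom A) :=
    fun A => MonoidHom.ext fun c => rfl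
  -- the component `β_A : B₁(A) → B₂(A)`, `(x, γ) ↦ (B₀(e_A) x, η_A^gp γ)`
  let βhom : ∀ A : Dᵒᵖ, T₁.BSub A →* T₂.BSub A := fun A =>
    ((MonoidHom.prodMap (β₀.app A).hom (MonGp.map (ηhom A))).comp (T₁.BSub A).subtype).codRestrict (T₂.BSub A)
      fun q => by
        obtain ⟨⟨x, γ⟩, hq⟩ := q
        have hq' : ((divZero p).app (op (base₁.obj A.unop))).hom x = MonGp.map (T₁.ι.app A).hom γ := hq
        -- naturality of `B₀ → Φ₀^gp` at `e_A`, then `Φ₀(e_A)^gp ∘ ι₁^gp = ι₂^gp ∘ η_A^gp`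
        have n1 := congrArg (fun φ => φ.hom x) ((divZero p).naturality (e.app A.unop).op)
        simp only [CommMonCat.hom_comp, MonoidHom.comp_apply] at n1
        have h2 : (MonGp.map ((phiZero p).map (e.app A.unop).op).hom).comp (MonGp.map (T₁.ι.app A).hom) =
            (MonGp.map (T₂.ι.app A).hom).comp (MonGp.map (ηhom A)) :=
          (MonGp.map_comp _ _).symm.trans ((congrArg MonGp.map (hιη A)).trans (MonGp.map_comp _ _))
        exact n1.trans ((congrArg (MonGp.map ((phiZero p).map (e.app A.unop).op).hom) hq').trans
          (DFunLike.congr_fun h2 γ))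
  let β : T₁.B ⟶ (𝟭 D).op ⋙ T₂.B :=
    { app := fun A => CommMonCat.ofHom (βhom A)
      naturality := fun A A' f => by
        apply CommMonCat.hom_ext
        refine MonoidHom.ext fun q => Subtype.ext (Prod.ext ?_ ?_)
        · have n0 := congrArg (fun φ => φ.hom q.1.1) (β₀.naturality f)
          simp only [CommMonCat.hom_comp, MonoidHom.comp_apply] at n0
          exact n0
        · have n2 := congrArg (fun φ => φ.hom q.1.2) ((Functor.whiskerRight η MonGp.functor).naturality f)
          simp only [CommMonCat.hom_comp, MonoidHom.comp_apply] at n2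
          exact n2 }
  exact ⟨⟨η, β, fun A u => rfl⟩, fun A c => rfl, fun A b => rfl⟩

/-- **Bijectivity for a base ISOMORPHISM.**  If `e = eb⁻¹` for a natural isomorphism `eb : base₁ ≅ base₂` and `Φ₀(eb_A)`
carries `Φ₂(A)` back into `Φ₁(A)`, then every data morphism over `𝟭_D` with the value formulas of
`exists_dataHomOver_of_baseHom` has BIJECTIVE components `η_A`, `β_A` (`Φ₀(eb_A)`, `B₀(eb_A)` are inverse on `Φ₀`, `B₀`;
on `B = B₀|_D ×_{Φ₀^gp} Φ^gp` a preimage `(B₀(eb_A) x', (η_A^gp)⁻¹ γ')` lies in `B₁(A)` because `Φ₀(eb⁻¹_A)^gp` is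
injective and `B₀ → Φ₀^gp` is natural). [cite: MochizukiFrdII2008, Ex 1.1 (ii) p.8] -/
theorem bijective_of_baseIso (eb : base₁ ≅ base₂)
    (hS' : ∀ (A : D) (y : Realification (OrdInt (base₂.obj A).K)), y ∈ T₂.S A →
      ((phiZero p).map (eb.hom.app A).op).hom y ∈ T₁.S A)
    (h : ModelFrobenioid.DataHomOver (𝟭 D) T₁.divB T₂.divB)
    (hη : ∀ (A : D) (c : T₁.Φ.obj (op A)),
      (T₂.ι.app (op A)).hom ((h.η.app (op A)).hom c) =
        ((phiZero p).map (eb.inv.app A).op).hom ((T₁.ι.app (op A)).hom c))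
    (hβ : ∀ (A : D) (b : T₁.B.obj (op A)),
      (T₂.toB0.app (op A)).hom ((h.β.app (op A)).hom b) =
        ((bZero p).map (eb.inv.app A).op).hom ((T₁.toB0.app (op A)).hom b)) :
    (∀ A : D, Bijective (h.η.app (op A)).hom) ∧ (∀ A : D, Bijective (h.β.app (op A)).hom) := by
  have hΦinj : ∀ A : D, Injective ((phiZero p).map (eb.inv.app A).op).hom := fun A =>
    HasLeftInverse.injective ⟨_, fun x => map_op_hom_map_op_inv_apply (phiZero p) (eb.app A) x⟩
  -- `η_A` is bijective: `ι₂ ∘ η_A = Φ₀(eb⁻¹_A) ∘ ι₁` with `ι₂`, `Φ₀(eb⁻¹_A)` injective; a preimage of `y` is `Φ₀(eb_A) y`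
  have hηbij : ∀ A : D, Bijective (h.η.app (op A)).hom := fun A => by
    constructor
    · intro c c' hcc
      apply T₁.ι_injective (op A)
      apply hΦinj A
      rw [← hη, ← hη, hcc]
    · intro y
      refine ⟨⟨((phiZero p).map (eb.hom.app A).op).hom ((T₂.ι.app (op A)).hom y), hS' A _ y.2⟩, ?_⟩
      apply T₂.ι_injective (op A)
      rw [hη]
      exact map_op_inv_map_op_hom_apply (phiZero p) (eb.app A) _
  have hgp : ∀ A : D, Bijective (MonGp.map (h.η.app (op A)).hom) := fun A =>
    gpMap_bijective_of_bijective _ (hηbij A)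
  refine ⟨hηbij, fun A => ⟨fun b b' hbb => ?_, fun b' => ?_⟩⟩
  · -- injectivity of `β_A`: both coordinates of `B(A) ⊆ B₀(A) × Φ(A)^gp` are recovered injectively
    apply Subtype.ext
    apply Prod.ext
    · have h1 := congrArg (T₂.toB0.app (op A)).hom hbb
      rw [hβ, hβ] at h1
      exact HasLeftInverse.injective ⟨_, fun x => map_op_hom_map_op_inv_apply (bZero p) (eb.app A) x⟩ h1
    · have h2 := congrArg (Frobenioids.divB ((𝟭 D).op ⋙ T₂.Φ) ((𝟭 D).op ⋙ T₂.B)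
        (ModelFrobenioid.divBRestrict (𝟭 D) T₂.Φ T₂.B T₂.divB) (op A)) hbb
      rw [← h.comm, ← h.comm] at h2
      exact (hgp A).1 h2
  · -- surjectivity of `β_A`
    obtain ⟨⟨x', γ'⟩, hq'⟩ := b'
    obtain ⟨γ, hγ⟩ := (hgp A).2 γ'
    have hq'' : ((divZero p).app (op (base₂.obj A))).hom x' = MonGp.map (T₂.ι.app (op A)).hom γ' := hq'
    -- the candidate `(B₀(eb_A) x', γ)`
    let x : (bZeroOn base₁).obj (op A) := ((bZero p).map (eb.hom.app A).op).hom x'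
    have hx : ((bZero p).map (eb.inv.app A).op).hom x = x' := map_op_inv_map_op_hom_apply (bZero p) (eb.app A) x'
    have hmem : (x, γ) ∈ T₁.BSub (op A) := by
      rw [mem_BSub_iff]
      -- test membership after the injective map `Φ₀(eb⁻¹_A)^gp`
      have hinj : Injective ((monoidGp (phiZero p)).map (eb.inv.app A).op).hom :=
        HasLeftInverse.injective ⟨_, fun z => map_op_hom_map_op_inv_apply (monoidGp (phiZero p)) (eb.app A) z⟩
      apply hinj
      have n1 := congrArg (fun φ => φ.hom x) ((divZero p).naturality (eb.inv.app A).op)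
      simp only [CommMonCat.hom_comp, MonoidHom.comp_apply] at n1
      have h3 : (MonGp.map ((phiZero p).map (eb.inv.app A).op).hom).comp (MonGp.map (T₁.ι.app (op A)).hom) =
          (MonGp.map (T₂.ι.app (op A)).hom).comp (MonGp.map (h.η.app (op A)).hom) :=
        (MonGp.map_comp _ _).symm.trans
          ((congrArg MonGp.map (MonoidHom.ext fun c => (hη A c).symm)).trans (MonGp.map_comp _ _))
      exact (n1.symm.trans ((congrArg ((divZero p).app (op (base₂.obj A))).hom hx).trans hq'')).trans
        ((DFunLike.congr_fun h3 γ).trans (congrArg (MonGp.map (T₂.ι.app (op A)).hom) hγ)).symm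
    refine ⟨⟨(x, γ), hmem⟩, Subtype.ext (Prod.ext ?_ ?_)⟩
    · exact (hβ A _).trans hx
    · exact (h.comm (op A) _).symm.trans hγ

/-- **The `p`-adic Frobenioids of subfunctors exchanged by a base isomorphism are EQUIVALENT over the identity of the
base** ("the horizontal arrows are equivalences of categories", [FrdI] Cor. 5.4, in abc-iut-w5-d137's form
`DataHomOver.functor_isEquivalence`): for `eb : base₁ ≅ base₂` with `Φ₀(eb⁻¹_A)(Φ₁(A)) ⊆ Φ₂(A)` and
`Φ₀(eb_A)(Φ₂(A)) ⊆ Φ₁(A)` there is an equivalence `F : C₁ ≌ C₂` of the model Frobenioids with `F ⋙ Base₂ = Base₁` ON THE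
NOSE (hence `≅`) and `deg_Fr(F φ) = deg_Fr(φ)`. [cite: MochizukiFrdI2008, Cor. 5.4 p.104] -/
theorem exists_equivalence_of_baseIso (eb : base₁ ≅ base₂)
    (hS : ∀ (A : D) (x : Realification (OrdInt (base₁.obj A).K)), x ∈ T₁.S A →
      ((phiZero p).map (eb.inv.app A).op).hom x ∈ T₂.S A)
    (hS' : ∀ (A : D) (y : Realification (OrdInt (base₂.obj A).K)), y ∈ T₂.S A →
      ((phiZero p).map (eb.hom.app A).op).hom y ∈ T₁.S A) :
    ∃ F : ModelFrobenioid T₁.Φ T₁.B T₁.divB ≌ ModelFrobenioid T₂.Φ T₂.B T₂.divB,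
      F.functor ⋙ ModelFrobenioid.baseFunctor T₂.Φ T₂.B T₂.divB = ModelFrobenioid.baseFunctor T₁.Φ T₁.B T₁.divB ∧
      Nonempty (F.functor ⋙ ModelFrobenioid.baseFunctor T₂.Φ T₂.B T₂.divB ≅
        ModelFrobenioid.baseFunctor T₁.Φ T₁.B T₁.divB) ∧
      ∀ (X Y : ModelFrobenioid T₁.Φ T₁.B T₁.divB) (φ : X ⟶ Y),
        ModelFrobenioid.degFr (F.functor.map φ) = ModelFrobenioid.degFr φ := by
  obtain ⟨h, hη, hβ⟩ := T₁.exists_dataHomOver_of_baseHom T₂ eb.inv hS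
  obtain ⟨hηb, hβb⟩ := T₁.bijective_of_baseIso T₂ eb hS' h hη hβ
  haveI := h.functor_isEquivalence hηb hβb
  have hF : h.functor ⋙ ModelFrobenioid.baseFunctor T₂.Φ T₂.B T₂.divB = ModelFrobenioid.baseFunctor T₁.Φ T₁.B T₁.divB :=
    h.functor_comp_baseFunctor.trans (Functor.comp_id _)
  exact ⟨h.functor.asEquivalence, hF, ⟨eqToIso hF⟩, fun X Y φ => h.degFr_functor_map φ⟩

end SubDatum

/-! ### §2 The headline: the perfection `Φ = ord(O^⊳)^pf` ([IUTchI] Ex. 3.3 (i) `𝒞_v`) -/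

section Perfection

variable [Fact p.Prime]

/-- The perfection datum is fieldwise saturated: `ord(O_{K_A}^⊳) ⊗ 1 ⊆ ord(O_{K_A}^⊳)^pf = Φ(A)` (abc-iut-L1-d6 gen 13's
one-liner `ScratchPerfFieldwiseSaturated`, staged unfiled; landed here for the junction).
[cite: MochizukiFrdII2008, Ex 1.1 (ii) p.8] -/
theorem Datum.perf_isFieldwiseSaturated (base : D ⥤ PadicFld.{u} p) (hloc : ∀ A : D, (base.obj A).IsPadicLocal)
    (hc : IsConnected D) (he : IsTotallyEpimorphic D) : (Datum.perf base hloc hc he).IsFieldwiseSaturated := by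
  intro A
  refine Subgroup.closure_mono ?_
  rintro _ ⟨a, rfl⟩
  exact ⟨⟨Realification.of _ a, Realification.of_mem_perf a⟩, rfl⟩

/-- **`Datum.perf` is functorial in isomorphisms of the base functor** (row R67/J2): for a natural isomorphism
`eb : base₁ ≅ base₂` of functors `D → D₀` into `p`-adic local fields (`D` connected, totally epimorphic), the `p`-adic
Frobenioids of the perfections `ord(O^⊳)^pf ⊆ Φ₀|_{base₁}`, `ord(O^⊳)^pf ⊆ Φ₀|_{base₂}` (print's `𝒞_v` of [IUTchI] Ex. 3.3
(i) over either base) are EQUIVALENT by an equivalence `F` with `F ⋙ Base₂ = Base₁` on the nose (hence `≅`) and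
`deg_Fr(F φ) = deg_Fr(φ)` — the perfection being carried to the perfection by every `Φ₀(g)` (`Realification.map_mem_perf`).
[cite: MochizukiFrdII2008, Ex 1.1 (ii) p.8] -/
theorem Datum.exists_equivalence_perf_of_baseIso {base₁ base₂ : D ⥤ PadicFld.{u} p} (eb : base₁ ≅ base₂)
    (hloc₁ : ∀ A : D, (base₁.obj A).IsPadicLocal) (hloc₂ : ∀ A : D, (base₂.obj A).IsPadicLocal)
    (hc : IsConnected D) (he : IsTotallyEpimorphic D) :
    ∃ F : (Datum.perf base₁ hloc₁ hc he).frobenioid ≌ (Datum.perf base₂ hloc₂ hc he).frobenioid,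
      F.functor ⋙ ModelFrobenioid.baseFunctor (Datum.perf base₂ hloc₂ hc he).Φ (Datum.perf base₂ hloc₂ hc he).B
          (Datum.perf base₂ hloc₂ hc he).divB =
        ModelFrobenioid.baseFunctor (Datum.perf base₁ hloc₁ hc he).Φ (Datum.perf base₁ hloc₁ hc he).B
          (Datum.perf base₁ hloc₁ hc he).divB ∧
      Nonempty (F.functor ⋙ ModelFrobenioid.baseFunctor (Datum.perf base₂ hloc₂ hc he).Φ (Datum.perf base₂ hloc₂ hc he).B
          (Datum.perf base₂ hloc₂ hc he).divB ≅
        ModelFrobenioid.baseFunctor (Datum.perf base₁ hloc₁ hc he).Φ (Datum.perf base₁ hloc₁ hc he).B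
          (Datum.perf base₁ hloc₁ hc he).divB) ∧
      ∀ (X Y : (Datum.perf base₁ hloc₁ hc he).frobenioid) (φ : X ⟶ Y),
        ModelFrobenioid.degFr (F.functor.map φ) = ModelFrobenioid.degFr φ :=
  (perfSubDatum base₁ hloc₁).exists_equivalence_of_baseIso (perfSubDatum base₂ hloc₂) eb
    (fun _ _ hx => Realification.map_mem_perf _ hx) (fun _ _ hy => Realification.map_mem_perf _ hy)

/-! ### §3 The junction: kernel triviality (`hker` of [IUTchI] Cor 5.3 (ii)) transports between isomorphic bases -/

/-- **abc-iut-L5-t4's kernel-triviality clause `hker` TRANSPORTS along a base isomorphism** (abc-iut-L1-t7's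
`CatIsomorphism.kernelTrivial_of_equivalence_over`, p504709, applied to the equivalence of §2): if every self-equivalence
of `(Datum.perf base₂ …).frobenioid` lying over `𝟭_D` is `≅ 𝟭`, then so is every self-equivalence of
`(Datum.perf base₁ …).frobenioid` lying over `𝟭_D`, for `eb : base₁ ≅ base₂`.
([IUTchI] Cor 5.3 (ii) p.144) [claim: Mochizuki2012, status: disputed] -/
theorem Datum.perf_kernelTrivial_of_baseIso {base₁ base₂ : D ⥤ PadicFld.{u} p} (eb : base₁ ≅ base₂)
    (hloc₁ : ∀ A : D, (base₁.obj A).IsPadicLocal) (hloc₂ : ∀ A : D, (base₂.obj A).IsPadicLocal)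
    (hc : IsConnected D) (he : IsTotallyEpimorphic D)
    (hker₂ : ∀ Ψ' : (Datum.perf base₂ hloc₂ hc he).frobenioid ≌ (Datum.perf base₂ hloc₂ hc he).frobenioid,
      Nonempty (CatIsomorphism.LiesUnder
        (ModelFrobenioid.baseFunctor (Datum.perf base₂ hloc₂ hc he).Φ (Datum.perf base₂ hloc₂ hc he).B
          (Datum.perf base₂ hloc₂ hc he).divB)
        (ModelFrobenioid.baseFunctor (Datum.perf base₂ hloc₂ hc he).Φ (Datum.perf base₂ hloc₂ hc he).B
          (Datum.perf base₂ hloc₂ hc he).divB) Ψ' (CategoryTheory.Equivalence.refl (C := D))) →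
      Nonempty (Ψ'.functor ≅ 𝟭 (Datum.perf base₂ hloc₂ hc he).frobenioid)) :
    ∀ Ψ : (Datum.perf base₁ hloc₁ hc he).frobenioid ≌ (Datum.perf base₁ hloc₁ hc he).frobenioid,
      Nonempty (CatIsomorphism.LiesUnder
        (ModelFrobenioid.baseFunctor (Datum.perf base₁ hloc₁ hc he).Φ (Datum.perf base₁ hloc₁ hc he).B
          (Datum.perf base₁ hloc₁ hc he).divB)
        (ModelFrobenioid.baseFunctor (Datum.perf base₁ hloc₁ hc he).Φ (Datum.perf base₁ hloc₁ hc he).B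
          (Datum.perf base₁ hloc₁ hc he).divB) Ψ (CategoryTheory.Equivalence.refl (C := D))) →
      Nonempty (Ψ.functor ≅ 𝟭 (Datum.perf base₁ hloc₁ hc he).frobenioid) := by
  obtain ⟨F, -, ⟨hF⟩, -⟩ := Datum.exists_equivalence_perf_of_baseIso eb hloc₁ hloc₂ hc he
  exact CatIsomorphism.kernelTrivial_of_equivalence_over _ _ F hF hker₂

/-- `hker` for `Datum.perf base₁ …` iff `hker` for `Datum.perf base₂ …`, for `eb : base₁ ≅ base₂`
(abc-iut-L1-t7's `CatIsomorphism.kernelTrivial_iff_of_equivalence_over`).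
([IUTchI] Cor 5.3 (ii) p.144) [claim: Mochizuki2012, status: disputed] -/
theorem Datum.perf_kernelTrivial_iff_of_baseIso {base₁ base₂ : D ⥤ PadicFld.{u} p} (eb : base₁ ≅ base₂)
    (hloc₁ : ∀ A : D, (base₁.obj A).IsPadicLocal) (hloc₂ : ∀ A : D, (base₂.obj A).IsPadicLocal)
    (hc : IsConnected D) (he : IsTotallyEpimorphic D) :
    (∀ Ψ : (Datum.perf base₁ hloc₁ hc he).frobenioid ≌ (Datum.perf base₁ hloc₁ hc he).frobenioid,
      Nonempty (CatIsomorphism.LiesUnder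
        (ModelFrobenioid.baseFunctor (Datum.perf base₁ hloc₁ hc he).Φ (Datum.perf base₁ hloc₁ hc he).B
          (Datum.perf base₁ hloc₁ hc he).divB)
        (ModelFrobenioid.baseFunctor (Datum.perf base₁ hloc₁ hc he).Φ (Datum.perf base₁ hloc₁ hc he).B
          (Datum.perf base₁ hloc₁ hc he).divB) Ψ (CategoryTheory.Equivalence.refl (C := D))) →
      Nonempty (Ψ.functor ≅ 𝟭 (Datum.perf base₁ hloc₁ hc he).frobenioid)) ↔
    (∀ Ψ' : (Datum.perf base₂ hloc₂ hc he).frobenioid ≌ (Datum.perf base₂ hloc₂ hc he).frobenioid,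
      Nonempty (CatIsomorphism.LiesUnder
        (ModelFrobenioid.baseFunctor (Datum.perf base₂ hloc₂ hc he).Φ (Datum.perf base₂ hloc₂ hc he).B
          (Datum.perf base₂ hloc₂ hc he).divB)
        (ModelFrobenioid.baseFunctor (Datum.perf base₂ hloc₂ hc he).Φ (Datum.perf base₂ hloc₂ hc he).B
          (Datum.perf base₂ hloc₂ hc he).divB) Ψ' (CategoryTheory.Equivalence.refl (C := D))) →
      Nonempty (Ψ'.functor ≅ 𝟭 (Datum.perf base₂ hloc₂ hc he).frobenioid)) := by
  obtain ⟨F, -, ⟨hF⟩, -⟩ := Datum.exists_equivalence_perf_of_baseIso eb hloc₁ hloc₂ hc he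
  exact CatIsomorphism.kernelTrivial_iff_of_equivalence_over _ _ F hF

end Perfection

/-! ### §3 (continued) `hker_genuine` with the base EQUALITY relaxed to a base ISOMORPHISM, at the perfection -/

section Genuine

open Literature.AnabelianGeometry.SemiGraphs Literature.AnabelianGeometry.AbsoluteAnabelian
open Literature.IUT.HodgeTheaters QuasiTemperoid

/-- **Kernel triviality of `Aut(𝒞_v) → Aut(𝒟_v)` at the perfection Frobenioid over ANY base functor ISOMORPHIC to a
genuine §2 base** (the `hd`-as-ISO form of abc-iut-L1-t7's `PadicFrd.Datum.hker_genuine`, p504140, wanted by the L5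
carriers `GoodLocalFrobenioid.ofGalois …` whose base `CosetCat.push aug ⋙ d.fieldFunctor` is isomorphic — not equal — to
the genuine form): for `Π` tempered, temp-slim, Galois-countable, `φ₁ : Π → G_{ℚ_p}` open, `ℬ(Π)⁰` slim, and ANY
`base : ℬ(Π)⁰ → D₀` into `p`-adic local fields with
`eb : base ≅ CosetCat.push φ₁ ⋙ CosetCat.toConnected ⋙ galoisPadicFields p`, every self-equivalence of
`(Datum.perf base …).frobenioid` lying over `𝟭_{ℬ(Π)⁰}` is `≅ 𝟭` — `hker_genuine` at the genuine perfection datum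
(`hd := rfl`; `hfs` = `Datum.perf_isFieldwiseSaturated`; (INT) = abc-iut-L1-t4's `Datum.perf_exists_ιHom_eq`; (PF) =
membership in the perfection) transported along the equivalence of §2 by `Datum.perf_kernelTrivial_of_baseIso`.  The
isomorphism `eb` (junction (J1), GaloisValDatum side) is an INPUT, not constructed here.
([IUTchI] Cor 5.3 (ii) p.144) [claim: Mochizuki2012, status: disputed] -/
theorem Datum.perf_hker_of_baseIso_genuine {p : ℕ} [Fact p.Prime] {G : Type} [Group G] [TopologicalSpace G]
    [IsTopologicalGroup G] [SecondCountableTopology G] (hG : IsTempered G) (hZ : IsSlimGroup G)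
    (φ₁ : G →* GalFbar ℚ_[p]) (hφ₁ : IsOpenHom φ₁) (hsl : IsSlim (CosetCat G))
    (base : CosetCat G ⥤ PadicFld.{0} p) (hloc : ∀ A : CosetCat G, (base.obj A).IsPadicLocal)
    (hc : IsConnected (CosetCat G)) (he : IsTotallyEpimorphic (CosetCat G))
    (eb : base ≅ CosetCat.push φ₁ hφ₁.isOpenMap ⋙ CosetCat.toConnected (isTempered_galFbar ℚ_[p]) ⋙
      galoisPadicFields p) :
    ∀ Ψ : (Datum.perf base hloc hc he).frobenioid ≌ (Datum.perf base hloc hc he).frobenioid,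
      Nonempty (CatIsomorphism.LiesUnder
        (ModelFrobenioid.baseFunctor (Datum.perf base hloc hc he).Φ (Datum.perf base hloc hc he).B
          (Datum.perf base hloc hc he).divB)
        (ModelFrobenioid.baseFunctor (Datum.perf base hloc hc he).Φ (Datum.perf base hloc hc he).B
          (Datum.perf base hloc hc he).divB) Ψ (CategoryTheory.Equivalence.refl (C := CosetCat G))) →
      Nonempty (Ψ.functor ≅ 𝟭 (Datum.perf base hloc hc he).frobenioid) :=
  Datum.perf_kernelTrivial_of_baseIso eb hloc (fun _ => isPadicLocal_galoisPadicFields p _) hc he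
    (Datum.hker_genuine hG hZ φ₁ hφ₁ (Datum.perf _ (fun _ => isPadicLocal_galoisPadicFields p _) hc he) hsl rfl
      (Datum.perf_isFieldwiseSaturated _ _ hc he) (Datum.perf_exists_ιHom_eq _ _ hc he)
      (fun A c => by
        obtain ⟨n, hn, a, ha⟩ := (Realification.mem_perf_iff _).mp c.2
        exact ⟨n, hn, a, ha.symm⟩))

end Genuine

end PadicFrd

end Literature.AlgebraicGeometry.Frobenioids
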